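import Summits.BirchSwinnertonDyer.BirchSwinnertonDyer.Theorems.ManinLocalTwoThreeManinConstantNinety
import Summits.BirchSwinnertonDyer.BirchSwinnertonDyer.Theorems.ManinLocalTwoThreeManinConstantOneSixtyTwo
import Summits.BirchSwinnertonDyer.BirchSwinnertonDyer.Theorems.ManinLocalTwoThreeManinConstantOneEighty
import Summits.BirchSwinnertonDyer.BirchSwinnertonDyer.Theorems.ManinLocalTwoThreeDyadicTwistFamiliesFactFree
import Summits.BirchSwinnertonDyer.BirchSwinnertonDyer.Theorems.ManinLocalTwoThreeNotTrivialEisensteinModThreeMultiplicativeUnconditional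
import HarnessLib

/-!
# Three more ADDITIVE roots for the fact-free twist families: `LevelManinOne 90`, `LevelManinOne 162`, `LevelManinOne 180`, their odd twist
# images, and the dyadic images of the `2`-multiplicative roots `90`, `162`

Cell bsd-f2-manin, route `ManinLocalTwoThree` (cruxes C2 `ManinOddAtFour` stmt-22967 / C3 `ManinPrimeToThreeAtNine` stmt-22968), prover seat p3 gen 26;
the twin of `…TwistRootsOneTwentySix` for this seat's three other complete levels: `LevelNinety.abs_maninConstant_eq_one_ninety` (`90 = 2·3²·5`),
`LevelOneSixtyTwo.abs_maninConstant_eq_one_oneSixtyTwo` (`162 = 2·3⁴`), `LevelOneEighty.abs_maninConstant_eq_one_oneEighty` (`180 = 2²·3²·5`) are verbatim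
`LevelManinOne 90 / 162 / 180`; the tree's engines (THEOREMS 68.A–C / 69.A) give `|c| = 1` on their `χ_p`-twist images (`p` odd, root datum good or
multiplicative at `p`) and — for the roots `90`, `162`, which are MULTIPLICATIVE at `2` with no hypothesis (`2 ∥ N`, Atkin–Lehner) — on the dyadic images
`90·16 = 1440`, `90·64 = 5760`, `162·16 = 2592`, `162·64 = 10368` (all in BOTH crux domains).

HONEST SCOPE.  The statements cover exactly the twist images (hypotheses as in the engines).  Nothing here proves C2, C3 (∀ N), the rung, Manin's
conjecture or BSD; items 22967/22968 stay OPEN.  No definition, no named fact, no sorry.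
[cite: Stevens1989, Lemma (5.2), (5.4), (5.6)–(5.7)] [cite: Pal2012, Prop. 2.4] [cite: AtkinLehner1970, Thm. 3] [cite: CremonaAlgorithms1997, Table 1 (90, 162, 180)]
-/

set_option autoImplicit false
-- lint-debt: the directory name repeats the summit name (sibling precedent `ManinLocalTwoThreeTwistRootsOneTwentySix.lean`)
set_option linter.dupNamespace false

noncomputable section

open Complex
open scoped MatrixGroups ModularForm
open ModularForm CongruenceSubgroup
open Literature.NumberTheory.EllipticCurves Literature.NumberTheory.EllipticCurves.ModularForms
open Summit.BirchSwinnertonDyer.BirchSwinnertonDyer.Theorems.ManinLocalTwoThree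

namespace Summit.BirchSwinnertonDyer.BirchSwinnertonDyer.Theorems.ManinLocalTwoThree.TwistRootsNinetyEtc

open WeierstrassCurve TwistFamilies DyadicTwistFamilies

/-! ## §1 The three roots -/

/-- **`LevelManinOne 90`** — level `90 = 2·3²·5` (classes `90a`, `90b` by Bracket–Sturm, `90c = 30a ⊗ χ₋₃` by the root-form transport) is COMPLETE,
fact-free (p3 g26). [cite: CremonaAlgorithms1997, Table 1 (90)] -/
theorem levelManinOne_ninety : LevelManinOne 90 :=
  fun W _ _ D h ↦ LevelNinety.abs_maninConstant_eq_one_ninety W D h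

/-- **`LevelManinOne 162`** — level `162 = 2·3⁴` (four classes, staged Bracket–Sturm certificates at depth 325) is COMPLETE, fact-free (p3 g26).
[cite: CremonaAlgorithms1997, Table 1 (162)] -/
theorem levelManinOne_oneSixtyTwo : LevelManinOne 162 :=
  fun W _ _ D h ↦ LevelOneSixtyTwo.abs_maninConstant_eq_one_oneSixtyTwo W D h

/-- **`LevelManinOne 180`** — level `180 = 2²·3²·5` (`180a = 20a ⊗ χ₋₃`, root-form transport; an g56's pinning) is COMPLETE, fact-free (p3 g26).
[cite: CremonaAlgorithms1997, Table 1 (180)] -/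
theorem levelManinOne_oneEighty : LevelManinOne 180 :=
  fun W _ _ D h ↦ LevelOneEighty.abs_maninConstant_eq_one_oneEighty W D h

/-! ## §2 Odd twist images (THEOREM 68.A) -/

/-- **`TwistLevelManinOne 90 p`, `TwistLevelManinOne 162 p`, `TwistLevelManinOne 180 p` for every odd prime `p`.** [cite: Stevens1989, Lemma (5.2), (5.4)] -/
theorem twistLevelManinOne_ninety_oneSixtyTwo_oneEighty {p : ℕ} [Fact p.Prime] (hp2 : p ≠ 2) :
    TwistLevelManinOne 90 p ∧ TwistLevelManinOne 162 p ∧ TwistLevelManinOne 180 p :=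
  ⟨twistLevelManinOne_of_levelManinOne levelManinOne_ninety hp2,
   twistLevelManinOne_of_levelManinOne levelManinOne_oneSixtyTwo hp2,
   twistLevelManinOne_of_levelManinOne levelManinOne_oneEighty hp2⟩

/-! ## §3 Dyadic images of the `2`-multiplicative roots `90`, `162` (THEOREM 69.A) -/

/-- **Every curve carrying an `X₀(90)`-datum is MULTIPLICATIVE at `2`** (`2 ∥ 90`, Atkin–Lehner; no hypothesis). [cite: AtkinLehner1970, Thm. 3] -/
theorem hasMultiplicativeReductionAtPrime_two_ninety {W : WeierstrassCurve ℚ} [W.IsElliptic] (D : ModularParametrizationData W 90) :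
    haveI : Fact (Nat.Prime 2) := ⟨Nat.prime_two⟩
    W.HasMultiplicativeReductionAtPrime 2 :=
  haveI : Fact (Nat.Prime 2) := ⟨Nat.prime_two⟩
  NotTrivialEisensteinUnconditional.hasMultiplicativeReductionAtPrime_of_isNewformOf_of_dvd_of_not_sq_dvd W D.isNewformOf
    (q := 2) ⟨45, rfl⟩ (by decide)

/-- **Every curve carrying an `X₀(162)`-datum is MULTIPLICATIVE at `2`** (`2 ∥ 162`). [cite: AtkinLehner1970, Thm. 3] -/
theorem hasMultiplicativeReductionAtPrime_two_oneSixtyTwo {W : WeierstrassCurve ℚ} [W.IsElliptic] (D : ModularParametrizationData W 162) :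
    haveI : Fact (Nat.Prime 2) := ⟨Nat.prime_two⟩
    W.HasMultiplicativeReductionAtPrime 2 :=
  haveI : Fact (Nat.Prime 2) := ⟨Nat.prime_two⟩
  NotTrivialEisensteinUnconditional.hasMultiplicativeReductionAtPrime_of_isNewformOf_of_dvd_of_not_sq_dvd W D.isNewformOf
    (q := 2) ⟨81, rfl⟩ (by decide)

/-- **`DyadicTwistLevelManinOne 90 d` and `DyadicTwistLevelManinOne 162 d`, `d ∈ {−1, 2, −2}`** (levels `1440`, `5760`, `2592`, `10368`, all in both
crux domains). [cite: Stevens1989, Lemma (5.6)–(5.7)] [cite: Pal2012, Prop. 2.4] -/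
theorem dyadicTwistLevelManinOne_ninety_oneSixtyTwo {d : ℤ} (hd : d = -1 ∨ d = 2 ∨ d = -2) :
    DyadicTwistLevelManinOne 90 d ∧ DyadicTwistLevelManinOne 162 d :=
  ⟨dyadicTwistLevelManinOne_of_levelManinOne levelManinOne_ninety hd,
   dyadicTwistLevelManinOne_of_levelManinOne levelManinOne_oneSixtyTwo hd⟩

/-- **C2 ∧ C3 on `90 ⊗ χ_d` (`d ∈ {−1, ±2}`; levels `1440 = 2⁵·3²·5`, `5760 = 2⁷·3²·5`)**: `|c(D')| = 1 ∧ 2 ∤ c ∧ 3 ∤ c` for every lattice-optimal datum `D'` at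
level `N` (`90 ∣ N`, `(4|d|)² ∣ N`) of a globally minimal `W'` additive at `2` and isogenous to `W ⊗ ℚ(√d)`, `W` the carrier of a lattice-optimal
`X₀(90)`-datum (multiplicative at `2` automatically, so Stevens' `η`-clause holds).  No printed fact. [cite: CremonaAlgorithms1997, Table 1 (1440, 5760)] -/
theorem shapes_on_family_ninety_dyadic {d : ℤ} (hd : d = -1 ∨ d = 2 ∨ d = -2)
    (W : WeierstrassCurve ℚ) [W.IsElliptic] [W.IsGloballyMinimal] (D : ModularParametrizationData W 90)
    (hopt : ∀ z ∈ D.L.lattice, ∃ w ∈ periodLattice D.f, z = D.c * w)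
    (W' : WeierstrassCurve ℚ) [W'.IsElliptic] [W'.IsGloballyMinimal] (N : ℕ) [NeZero N]
    (D' : ModularParametrizationData W' N) (hMN : 90 ∣ N) (hmN : (4 * d.natAbs) ^ 2 ∣ N)
    (htw : IsIsogenous W' (W.quadraticTwist (d : ℚ)))
    (hadd' : ¬ W'.HasGoodReductionAtPrime 2 ∧ ¬ W'.HasMultiplicativeReductionAtPrime 2)
    (hopt' : ∀ z ∈ D'.L.lattice, ∃ w ∈ periodLattice D'.f, z = D'.c * w) :
    |D'.maninConstant| = 1 ∧ ¬ (2 : ℤ) ∣ D'.maninConstant ∧ ¬ (3 : ℤ) ∣ D'.maninConstant :=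
  shapes_of_dyadicTwistLevelManinOne ((dyadicTwistLevelManinOne_ninety_oneSixtyTwo hd).1) W D hopt
    (Or.inr (hasMultiplicativeReductionAtPrime_two_ninety D)) (Or.inr (Or.inl (hasMultiplicativeReductionAtPrime_two_ninety D)))
    W' N D' hMN hmN htw hadd' hopt'

/-- **C2 ∧ C3 on `162 ⊗ χ_d` (`d ∈ {−1, ±2}`; levels `2592 = 2⁵·3⁴`, `10368 = 2⁷·3⁴`)**, same shape. [cite: CremonaAlgorithms1997, Table 1 (2592)] -/
theorem shapes_on_family_oneSixtyTwo_dyadic {d : ℤ} (hd : d = -1 ∨ d = 2 ∨ d = -2)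
    (W : WeierstrassCurve ℚ) [W.IsElliptic] [W.IsGloballyMinimal] (D : ModularParametrizationData W 162)
    (hopt : ∀ z ∈ D.L.lattice, ∃ w ∈ periodLattice D.f, z = D.c * w)
    (W' : WeierstrassCurve ℚ) [W'.IsElliptic] [W'.IsGloballyMinimal] (N : ℕ) [NeZero N]
    (D' : ModularParametrizationData W' N) (hMN : 162 ∣ N) (hmN : (4 * d.natAbs) ^ 2 ∣ N)
    (htw : IsIsogenous W' (W.quadraticTwist (d : ℚ)))
    (hadd' : ¬ W'.HasGoodReductionAtPrime 2 ∧ ¬ W'.HasMultiplicativeReductionAtPrime 2)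
    (hopt' : ∀ z ∈ D'.L.lattice, ∃ w ∈ periodLattice D'.f, z = D'.c * w) :
    |D'.maninConstant| = 1 ∧ ¬ (2 : ℤ) ∣ D'.maninConstant ∧ ¬ (3 : ℤ) ∣ D'.maninConstant :=
  shapes_of_dyadicTwistLevelManinOne ((dyadicTwistLevelManinOne_ninety_oneSixtyTwo hd).2) W D hopt
    (Or.inr (hasMultiplicativeReductionAtPrime_two_oneSixtyTwo D)) (Or.inr (Or.inl (hasMultiplicativeReductionAtPrime_two_oneSixtyTwo D)))
    W' N D' hMN hmN htw hadd' hopt'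

end Summit.BirchSwinnertonDyer.BirchSwinnertonDyer.Theorems.ManinLocalTwoThree.TwistRootsNinetyEtc

end
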